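import Mathlib
import HarnessLib
import Summits.NavierStokesRegularity.NavierStokesRegularity.Theorems.PoloidalWindowDoorLrcModEntireAxisKinematics

/-!
# Route `PoloidalWindowDoor`, item `LrcModEntire` (stmt-NavierStokesRegularity-20428) — AXIS KINEMATICS XII: «`P_rr = 0` along a plane
# ⇒ the profile is a Hill-type quadratic `k ρ² + m` there» (integration step)

Cell ns-regularity-ideate, seat ns-poloidal-K2-p3 gen 5 (LEAD of item 20428; file landed `--supports stmt-NavierStokesRegularity-20428` as a
helper).  Plan step VIII-c of AXIS-NOTE.  If `V(y) = P(ρ_c²(y), z₀)` at the points of height `z₀` near `x` (`x₂ = z₀`), `P ∈ C²` near,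
and `P_rr(ρ_c²(y), z₀) = 0` at those points, then `V(y) = k ρ_c²(y) + m` at the points of height `z₀` near `x`
(`k = P_r(ρ_c²(x), z₀)`).  The integration is done on the plane: a function on `ℝ³` whose two HORIZONTAL derivatives vanish at the
points of height `x₂` of a ball about `x` is constant there (`eq_of_horizontalFDeriv_eq_zero`, mean value theorem along horizontal
segments), applied first to `y ↦ P_r(ρ_c²(y), z₀)` and then to `y ↦ P(ρ_c²(y), z₀) − k ρ_c²(y)`.

* `hasDerivAt_sliceFst` — `r ↦ Q(r, z₀)` has derivative `DQ(r,z₀)(1,0)`.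
* `fderiv_comp_sqDist` — horizontal derivatives of `y ↦ φ(ρ_c²(y))`: `∂_b = φ′(ρ²) · 2(y_b − c_b)`.
* `eq_of_horizontalFDeriv_eq_zero` — planar constancy.
* `eq_quadratic_of_rr_eq_zero` — the statement above.

WHAT THIS IS NOT: not a claim about Navier–Stokes regularity — calculus (bears_on LADDER-NS N0 via item 20428).
-/

noncomputable section

-- the summit and its single sub-problem share the name (CONVENTIONS §1), as in every Theorems file
set_option linter.dupNamespace false

namespace Summit.NavierStokesRegularity.NavierStokesRegularity.Theorems.PoloidalWindowDoorLrcModEntireAxisKinematics12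

open Set Function Filter Topology Metric
open scoped RealInnerProductSpace InnerProductSpace
open Literature.Analysis Literature.Analysis.FluidPDE
open Summit.NavierStokesRegularity.NavierStokesRegularity.Theorems.PoloidalWindowDoorLrcModEntireAxisKinematics

/-! ### One-variable slices of `P` and the chain rule through `ρ²` -/

/-- `r ↦ Q(r, z₀)` has derivative `DQ(r, z₀)(1, 0)` where `Q` is differentiable. -/
theorem hasDerivAt_sliceFst {Q : ℝ × ℝ → ℝ} {r z₀ : ℝ} (hQ : DifferentiableAt ℝ Q (r, z₀)) :
    HasDerivAt (fun r' : ℝ => Q (r', z₀)) (fderiv ℝ Q (r, z₀) (1, 0)) r := by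
  have hι : HasDerivAt (fun r' : ℝ => (r', z₀)) ((1 : ℝ), (0 : ℝ)) r :=
    (hasDerivAt_id r).prodMk (hasDerivAt_const r z₀)
  exact hQ.hasFDerivAt.comp_hasDerivAt r hι

/-- **Chain rule through `ρ²`.**  For `φ : ℝ → ℝ` differentiable at `ρ_c²(y)`:
`∂₀[φ ∘ ρ_c²](y) = φ′(ρ_c²(y)) · 2(y₀ − c₀)` and `∂₁[φ ∘ ρ_c²](y) = φ′(ρ_c²(y)) · 2(y₁ − c₁)`. -/
theorem fderiv_comp_sqDist {φ : ℝ → ℝ} {c y : EuclideanSpace ℝ (Fin 3)}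
    (hφ : DifferentiableAt ℝ φ ((y 0 - c 0) ^ 2 + (y 1 - c 1) ^ 2)) :
    fderiv ℝ (fun y' : EuclideanSpace ℝ (Fin 3) => φ ((y' 0 - c 0) ^ 2 + (y' 1 - c 1) ^ 2)) y (EuclideanSpace.single 0 1) =
        deriv φ ((y 0 - c 0) ^ 2 + (y 1 - c 1) ^ 2) * (2 * (y 0 - c 0)) ∧
      fderiv ℝ (fun y' : EuclideanSpace ℝ (Fin 3) => φ ((y' 0 - c 0) ^ 2 + (y' 1 - c 1) ^ 2)) y (EuclideanSpace.single 1 1) =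
        deriv φ ((y 0 - c 0) ^ 2 + (y 1 - c 1) ^ 2) * (2 * (y 1 - c 1)) := by
  have h := hφ.hasDerivAt.comp_hasFDerivAt y (hasFDerivAt_sqDist c y)
  rw [show (fun y' : EuclideanSpace ℝ (Fin 3) => φ ((y' 0 - c 0) ^ 2 + (y' 1 - c 1) ^ 2)) =
      φ ∘ (fun y' : EuclideanSpace ℝ (Fin 3) => (y' 0 - c 0) ^ 2 + (y' 1 - c 1) ^ 2) from rfl, h.fderiv]
  constructor <;> simp

/-- Differentiability of `y ↦ φ(ρ_c²(y))`. -/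
theorem differentiableAt_comp_sqDist {φ : ℝ → ℝ} {c y : EuclideanSpace ℝ (Fin 3)}
    (hφ : DifferentiableAt ℝ φ ((y 0 - c 0) ^ 2 + (y 1 - c 1) ^ 2)) :
    DifferentiableAt ℝ (fun y' : EuclideanSpace ℝ (Fin 3) => φ ((y' 0 - c 0) ^ 2 + (y' 1 - c 1) ^ 2)) y :=
  hφ.comp y (hasFDerivAt_sqDist c y).differentiableAt

/-! ### Planar constancy -/

/-- **A function with vanishing horizontal derivatives along a plane is constant there (locally).**  If `f : ℝ³ → ℝ` is differentiable,
with `∂₀f = ∂₁f = 0`, at every point of height `x₂` of the ball `B(x, δ)`, then `f(y) = f(x)` for every such point `y` (mean value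
theorem along the horizontal segment `[x, y] ⊆ B(x, δ) ∩ {y₂ = x₂}`). -/
theorem eq_of_horizontalFDeriv_eq_zero {f : EuclideanSpace ℝ (Fin 3) → ℝ} {x : EuclideanSpace ℝ (Fin 3)} {δ : ℝ}
    (hd : ∀ y ∈ ball x δ, y 2 = x 2 → DifferentiableAt ℝ f y)
    (h0 : ∀ y ∈ ball x δ, y 2 = x 2 → fderiv ℝ f y (EuclideanSpace.single 0 1) = 0)
    (h1 : ∀ y ∈ ball x δ, y 2 = x 2 → fderiv ℝ f y (EuclideanSpace.single 1 1) = 0)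
    {y : EuclideanSpace ℝ (Fin 3)} (hy : y ∈ ball x δ) (hyz : y 2 = x 2) : f y = f x := by
  -- the horizontal direction `w = y − x`
  set w : EuclideanSpace ℝ (Fin 3) := y - x with hw
  have hw2 : w 2 = 0 := by simp [hw, hyz]
  have hwdec : w = w 0 • EuclideanSpace.single 0 (1 : ℝ) + w 1 • EuclideanSpace.single 1 (1 : ℝ) := by
    ext i
    fin_cases i <;> simp [hw2]
  have hwn : ‖w‖ < δ := by rw [hw, ← dist_eq_norm]; exact hy
  -- the segment `x + t w`, `t ∈ [0,1]`, stays in the ball and in the plane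
  have hγin : ∀ t ∈ Icc (0 : ℝ) 1, x + t • w ∈ ball x δ ∧ (x + t • w) 2 = x 2 := by
    intro t ht
    refine ⟨?_, by simp [hw2]⟩
    rw [mem_ball, dist_eq_norm, add_sub_cancel_left, norm_smul, Real.norm_eq_abs, abs_of_nonneg ht.1]
    calc t * ‖w‖ ≤ 1 * ‖w‖ := by gcongr; exact ht.2
      _ < δ := by rw [one_mul]; exact hwn
  -- `t ↦ f (x + t w)` has derivative `0` on `[0,1]`
  have hderiv : ∀ t ∈ Icc (0 : ℝ) 1, HasDerivAt (fun t : ℝ => f (x + t • w)) 0 t := by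
    intro t ht
    obtain ⟨hin, hz⟩ := hγin t ht
    have hγ : HasDerivAt (fun t : ℝ => x + t • w) w t := by
      simpa using ((hasDerivAt_id t).smul_const w).const_add x
    have h := (hd _ hin hz).hasFDerivAt.comp_hasDerivAt t hγ
    have hval : fderiv ℝ f (x + t • w) w = 0 := by
      calc fderiv ℝ f (x + t • w) w
          = fderiv ℝ f (x + t • w) (w 0 • EuclideanSpace.single 0 (1 : ℝ) + w 1 • EuclideanSpace.single 1 (1 : ℝ)) := by
            rw [← hwdec]
        _ = 0 := by rw [map_add, map_smul, map_smul, h0 _ hin hz, h1 _ hin hz, smul_zero, smul_zero, add_zero]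
    simpa [Function.comp_def, hval] using h
  have hcont : ContinuousOn (fun t : ℝ => f (x + t • w)) (Icc 0 1) := fun t ht =>
    (hderiv t ht).continuousAt.continuousWithinAt
  have hconst := constant_of_has_deriv_right_zero hcont
    (fun t ht => (hderiv t (Ico_subset_Icc_self ht)).hasDerivWithinAt)
  have h1' := hconst 1 (right_mem_Icc.2 zero_le_one)
  simpa [hw] using h1'

/-! ### The integration step -/

/-- **`P_rr = 0` along the plane ⇒ Hill-type quadratic.**  Let `x₂ = z₀`, `P ∈ C²` at the points `(ρ_c²(y), z₀)` for `y` near `x`,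
`V(y) = P(ρ_c²(y), z₀)` and `P_rr(ρ_c²(y), z₀) = 0` at the points `y` of height `z₀` near `x`
(`P_rr = D(q ↦ DP(q)(1,0))(·)(1,0)`).  Then for some `k m`: `V(y) = k ρ_c²(y) + m` at the points of height `z₀` near `x`. -/
theorem eq_quadratic_of_rr_eq_zero {V : EuclideanSpace ℝ (Fin 3) → ℝ} {P : ℝ × ℝ → ℝ} {c x : EuclideanSpace ℝ (Fin 3)} {z₀ : ℝ}
    (hxz : x 2 = z₀) (hP : ∀ᶠ y in 𝓝 x, ContDiffAt ℝ 2 P ((y 0 - c 0) ^ 2 + (y 1 - c 1) ^ 2, z₀))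
    (hV : ∀ᶠ y in 𝓝 x, y 2 = z₀ → V y = P ((y 0 - c 0) ^ 2 + (y 1 - c 1) ^ 2, z₀))
    (hrr : ∀ᶠ y in 𝓝 x, y 2 = z₀ →
      fderiv ℝ (fun q => fderiv ℝ P q (1, 0)) ((y 0 - c 0) ^ 2 + (y 1 - c 1) ^ 2, z₀) (1, 0) = 0) :
    ∃ k m : ℝ, ∀ᶠ y in 𝓝 x, y 2 = z₀ → V y = k * ((y 0 - c 0) ^ 2 + (y 1 - c 1) ^ 2) + m := by
  obtain ⟨δ, hδ, hball⟩ := Metric.eventually_nhds_iff_ball.1 (hP.and (hV.and hrr))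
  -- the one-variable slices `φ(r) = P(r, z₀)` and `φ₁(r) = P_r(r, z₀)`
  set φ : ℝ → ℝ := fun r => P (r, z₀) with hφ
  set φ₁ : ℝ → ℝ := fun r => fderiv ℝ P (r, z₀) (1, 0) with hφ₁
  have h2ne : (2 : WithTop ℕ∞) ≠ 0 := by norm_num
  -- derivatives of the slices at `r = ρ_c²(y)`, `y ∈ B(x, δ)`
  have hdφ : ∀ y ∈ ball x δ, HasDerivAt φ (φ₁ ((y 0 - c 0) ^ 2 + (y 1 - c 1) ^ 2)) ((y 0 - c 0) ^ 2 + (y 1 - c 1) ^ 2) :=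
    fun y hy => hasDerivAt_sliceFst ((hball y hy).1.differentiableAt h2ne)
  have hPr1 : ∀ y ∈ ball x δ, ContDiffAt ℝ 1 (fun q => fderiv ℝ P q (1, 0)) ((y 0 - c 0) ^ 2 + (y 1 - c 1) ^ 2, z₀) :=
    fun y hy => ((hball y hy).1.fderiv_right (m := 1) (by norm_num)).clm_apply contDiffAt_const
  have hdφ₁ : ∀ y ∈ ball x δ, HasDerivAt φ₁
      (fderiv ℝ (fun q => fderiv ℝ P q (1, 0)) ((y 0 - c 0) ^ 2 + (y 1 - c 1) ^ 2, z₀) (1, 0))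
      ((y 0 - c 0) ^ 2 + (y 1 - c 1) ^ 2) :=
    fun y hy => hasDerivAt_sliceFst ((hPr1 y hy).differentiableAt (by norm_num))
  -- Step 1: `g(y) = φ₁(ρ_c²(y))` is constant `k` along the plane in the ball
  set k : ℝ := φ₁ ((x 0 - c 0) ^ 2 + (x 1 - c 1) ^ 2) with hk
  have hg : ∀ y ∈ ball x δ, y 2 = x 2 → φ₁ ((y 0 - c 0) ^ 2 + (y 1 - c 1) ^ 2) = k := by
    intro y hy hyz
    refine eq_of_horizontalFDeriv_eq_zero (f := fun y' => φ₁ ((y' 0 - c 0) ^ 2 + (y' 1 - c 1) ^ 2)) (x := x) (δ := δ)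
      (fun y' hy' _ => differentiableAt_comp_sqDist (hdφ₁ y' hy').differentiableAt) ?_ ?_ hy hyz
    · intro y' hy' hy'z
      rw [(fderiv_comp_sqDist (hdφ₁ y' hy').differentiableAt).1, (hdφ₁ y' hy').deriv,
        (hball y' hy').2.2 (hy'z.trans hxz), zero_mul]
    · intro y' hy' hy'z
      rw [(fderiv_comp_sqDist (hdφ₁ y' hy').differentiableAt).2, (hdφ₁ y' hy').deriv,
        (hball y' hy').2.2 (hy'z.trans hxz), zero_mul]
  -- Step 2: `f(y) = φ(ρ_c²(y)) − k ρ_c²(y)` is constant `m` along the plane in the ball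
  set m : ℝ := φ ((x 0 - c 0) ^ 2 + (x 1 - c 1) ^ 2) - k * ((x 0 - c 0) ^ 2 + (x 1 - c 1) ^ 2) with hm
  have hf : ∀ y ∈ ball x δ, y 2 = x 2 →
      φ ((y 0 - c 0) ^ 2 + (y 1 - c 1) ^ 2) - k * ((y 0 - c 0) ^ 2 + (y 1 - c 1) ^ 2) = m := by
    intro y hy hyz
    have hψ : ∀ y' : EuclideanSpace ℝ (Fin 3), HasDerivAt (fun r : ℝ => φ r - k * r)
        (φ₁ ((y' 0 - c 0) ^ 2 + (y' 1 - c 1) ^ 2) - k) ((y' 0 - c 0) ^ 2 + (y' 1 - c 1) ^ 2) →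
        DifferentiableAt ℝ (fun r : ℝ => φ r - k * r) ((y' 0 - c 0) ^ 2 + (y' 1 - c 1) ^ 2) := fun y' h => h.differentiableAt
    have hψ' : ∀ y' ∈ ball x δ, HasDerivAt (fun r : ℝ => φ r - k * r)
        (φ₁ ((y' 0 - c 0) ^ 2 + (y' 1 - c 1) ^ 2) - k) ((y' 0 - c 0) ^ 2 + (y' 1 - c 1) ^ 2) := by
      intro y' hy'
      have := (hdφ y' hy').sub ((hasDerivAt_id _).const_mul k)
      simp only [id, mul_one] at this
      exact this
    refine eq_of_horizontalFDeriv_eq_zero (f := fun y' => φ ((y' 0 - c 0) ^ 2 + (y' 1 - c 1) ^ 2) - k * ((y' 0 - c 0) ^ 2 + (y' 1 - c 1) ^ 2))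
      (x := x) (δ := δ) (fun y' hy' _ => differentiableAt_comp_sqDist (φ := fun r => φ r - k * r) (hψ y' (hψ' y' hy'))) ?_ ?_ hy hyz
    · intro y' hy' hy'z
      rw [(fderiv_comp_sqDist (φ := fun r => φ r - k * r) (hψ y' (hψ' y' hy'))).1, (hψ' y' hy').deriv, hg y' hy' hy'z, sub_self,
        zero_mul]
    · intro y' hy' hy'z
      rw [(fderiv_comp_sqDist (φ := fun r => φ r - k * r) (hψ y' (hψ' y' hy'))).2, (hψ' y' hy').deriv, hg y' hy' hy'z, sub_self,
        zero_mul]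
  -- conclusion
  refine ⟨k, m, ?_⟩
  filter_upwards [ball_mem_nhds x hδ] with y hy hyz
  rw [(hball y hy).2.1 hyz]
  have := hf y hy (hyz.trans hxz.symm)
  simp only [hφ] at this
  linarith

end Summit.NavierStokesRegularity.NavierStokesRegularity.Theorems.PoloidalWindowDoorLrcModEntireAxisKinematics12

end
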